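/- Free-seat work of EXTRA WIDTH SEAT `ym-line-cbag-p1-w5` (prover-ym-line-cbag-p1-w5-g8-0), route `EguchiKawaiDirectionLadder`
(ideator ym-idea-2, LINE 8): post-closure glue for the barrier entry `EguchiKawaiBreakdown` (crux stmt-QuantumFields-27724,
CLOSED·proved).  ROUTE-INDEPENDENT (imports only `Literature`).  HONEST FRAMING: a theorem about the single-site Eguchi–Kawai model in
`d ≤ 2`; nothing here bears on the Yang–Mills mass gap (no summit statement, no continuum limit, no large-`N` reduction of the
`d`-dimensional lattice theory is proved or advanced). -/
import Literature.Barriers.QuantumFields.EguchiKawaiBreakdownProofs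
import Literature.Barriers.QuantumFields.EguchiKawaiBreakdownSpecialUnitary
import Literature.LinearAlgebra.Matrix.UnitaryGroupMaximalTorus
import HarnessLib

/-!
# Route `EguchiKawaiDirectionLadder`: the `d = 2` Eguchi–Kawai model is centre symmetric at EVERY coupling

Evasion (e) of the barrier entry `Literature.Barriers.QuantumFields.EguchiKawaiBreakdown` — "`d = 2`, where the naive
reduction is valid" (Makeenko, *Methods of Contemporary Gauge Theory*, §14.4, PDF p. 250; §14.5 (14.77): "For `d = 2` the
exponent `2 − d` vanishes") — as a THEOREM about the integrals (14.40)/(14.43), at every finite `N` and every real coupling `b`: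
* `ekOrderParameter_two_le` — `⟨|(1/N) tr U_μ|²⟩_EK ≤ 1/N` for `d = 2`, all `b ∈ ℝ`, `N ≥ 1`, `μ` (sharp at weak coupling);
* `ekOpenLinesVanish_two`, `ekOpenLinesVanish_of_le_two`, `ekOpenLinesVanishSU_of_le_two` — the standing hypothesis
  `EKOpenLinesVanish d b` of the reduction holds for EVERY `b` when `d ≤ 2` (the tree had only `b = 0`), also for `SU(N)`;
* the companion file `EguchiKawaiDirectionLadderDimensionThreshold.lean` combines this with `EguchiKawaiBreakdown_holds`
  (LINE 8): the Eguchi–Kawai breakdown at weak coupling happens IF AND ONLY IF `d ≥ 3` (the tree's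
  `not_exists_margin_of_le_two` only excluded the free-energy MECHANISM for `d ≤ 2`; here is the positive statement).

Proof (elementary — Haar left invariance and one diagonalisation; no characters, no Weyl formula, no Bakry–Émery).  Write the
two links as `(A, V)`.  By Fubini (`finTwoArrow`) numerator and `Z_EK` are integrals over `A` of one-link Haar integrals in `V`
with weight `w_A(V) = e^{−N² b S_R[A,V]}`.  For FIXED `A` diagonalise `A = P Λ P⁻¹` (`exists_conj_mem_diagonalTorus`; pointwise, no
measurable selection) and let `D_i = P S_i P⁻¹`, `S_i` the sign flip of row `i` (`rowSignUnitary`).  `D_i` commutes with `A`;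
each plaquette word `V⁻¹A⁻¹VA`, `A⁻¹V⁻¹AV` carries `V`, `V⁻¹` once each with `A^{±1}` between, so `w_A(D_i V) = w_A(V)`.  With
`a = P⁻¹VP` (`tr V = tr a`) the substitution `V ↦ D_i V` (Haar LEFT invariance) flips row `i` of `a`: the weighted cross moments
`∫ w_A Re(a_ii ā_jj)`, `i ≠ j`, vanish, and `|a_ii| ≤ 1` gives `∫ w_A |tr V|² ≤ N ∫ w_A` for EVERY `A`; integrate over `A` and use the
direction symmetry `ekOrderParameter_eq`.  (Why `d = 2`: the centraliser torus of ONE other link acts on the measured link; for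
`d ≥ 3` the joint commutant of the other links is generically the centre `U(1)` — the symmetry whose breaking LINE 8 proved.)
Reference: Y. Makeenko, *Methods of Contemporary Gauge Theory* (CUP, reissue 2023), §14.3–§14.5 (PDF pp. 244–251).
-/

set_option autoImplicit false

noncomputable section

open MeasureTheory Filter Topology
open scoped Matrix ComplexConjugate
open Literature.Barriers.QuantumFields
open Literature.LinearAlgebra.Matrix (diagonalTorus mem_diagonalTorus_iff exists_conj_mem_diagonalTorus
  mul_comm_of_mem_diagonalTorus)

namespace Summit.QuantumFields.YangMills.Theorems.EguchiKawaiDirectionLadder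

namespace TwoDim

variable {N : ℕ}

/-! ### §1  A weighted second moment of the trace on `U(N)` -/

/-- The trace is a class function: `tr(P⁻¹ U P) = tr U`. -/
theorem trace_conj_eq (P U : UN N) :
    Matrix.trace ((P⁻¹ * U * P : UN N) : Matrix (Fin N) (Fin N) ℂ) =
      Matrix.trace (U : Matrix (Fin N) (Fin N) ℂ) := by
  rw [Matrix.UnitaryGroup.mul_val, Matrix.UnitaryGroup.mul_val, Matrix.trace_mul_cycle,
    ← Matrix.UnitaryGroup.mul_val, mul_inv_cancel, Matrix.UnitaryGroup.one_val, Matrix.one_mul]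

/-- Conjugating the left translate by `P S P⁻¹` is the left translate of the conjugate by `S`. -/
theorem conj_mul_conj_eq (P S U : UN N) : P⁻¹ * (P * S * P⁻¹ * U) * P = S * (P⁻¹ * U * P) := by
  group

/-- The row sign flip is an element of the diagonal torus. -/
theorem rowSignUnitary_mem_diagonalTorus (i : Fin N) : rowSignUnitary i ∈ diagonalTorus (Fin N) :=
  mem_diagonalTorus_iff.2 ⟨fun k => if k = i then (-1 : ℂ) else 1, rfl⟩

/-- If `P⁻¹ A P` is diagonal then `P S_i P⁻¹` commutes with `A`. -/
theorem conj_rowSign_mul_comm {P A : UN N} (hA : P⁻¹ * A * P ∈ diagonalTorus (Fin N)) (i : Fin N) :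
    P * rowSignUnitary i * P⁻¹ * A = A * (P * rowSignUnitary i * P⁻¹) := by
  have hc := mul_comm_of_mem_diagonalTorus (rowSignUnitary_mem_diagonalTorus i) hA
  calc P * rowSignUnitary i * P⁻¹ * A = P * (rowSignUnitary i * (P⁻¹ * A * P)) * P⁻¹ := by group
    _ = P * ((P⁻¹ * A * P) * rowSignUnitary i) * P⁻¹ := by rw [hc]
    _ = A * (P * rowSignUnitary i * P⁻¹) := by group

/-- The entries of the conjugate `P⁻¹ U P` depend continuously on `U`. -/
theorem continuous_conj_entry (P : UN N) (i j : Fin N) :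
    Continuous fun U : UN N => ((P⁻¹ * U * P : UN N) : Matrix (Fin N) (Fin N) ℂ) i j :=
  (continuous_entry i j).comp ((continuous_const.mul continuous_id).mul continuous_const)

/-- **Weighted cross moments vanish.**  If the weight `w` is invariant under left multiplication by
`D_i = P S_i P⁻¹`, then `∫ w(U) Re(a_ii ā_jj) dU = 0` for `i ≠ j`, `a = P⁻¹ U P` (left invariance of Haar measure:
`U ↦ D_i U` flips the sign of row `i` of `a` and fixes row `j`). -/
theorem integral_mul_re_conj_diag_eq_zero (P : UN N) {w : UN N → ℝ} {i j : Fin N} (hij : i ≠ j)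
    (hw : ∀ U, w (P * rowSignUnitary i * P⁻¹ * U) = w U) :
    ∫ U, w U * (((P⁻¹ * U * P : UN N) : Matrix (Fin N) (Fin N) ℂ) i i *
        conj (((P⁻¹ * U * P : UN N) : Matrix (Fin N) (Fin N) ℂ) j j)).re ∂haarUN N = 0 := by
  set D : UN N := P * rowSignUnitary i * P⁻¹ with hD
  set f : UN N → ℝ := fun U => w U * (((P⁻¹ * U * P : UN N) : Matrix (Fin N) (Fin N) ℂ) i i *
        conj (((P⁻¹ * U * P : UN N) : Matrix (Fin N) (Fin N) ℂ) j j)).re with hf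
  have hmp : MeasurePreserving (fun U : UN N => D * U) (haarUN N) (haarUN N) := measurePreserving_mul_left _ _
  have hemb : MeasurableEmbedding (fun U : UN N => D * U) := (MeasurableEquiv.mulLeft D).measurableEmbedding
  have hconj : ∀ U : UN N, P⁻¹ * (D * U) * P = rowSignUnitary i * (P⁻¹ * U * P) := fun U => by
    rw [hD]; exact conj_mul_conj_eq P (rowSignUnitary i) U
  have key : ∫ U, f U ∂haarUN N = -∫ U, f U ∂haarUN N := by
    calc ∫ U, f U ∂haarUN N = ∫ U, f (D * U) ∂haarUN N := by rw [← hmp.integral_comp hemb]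
      _ = -∫ U, f U ∂haarUN N := by
          rw [← integral_neg]
          refine integral_congr_ae (Eventually.of_forall fun U => ?_)
          simp only [hf, hw, hconj, rowSignUnitary_mul_apply, if_neg hij.symm]
          simp
          ring
  show ∫ U, f U ∂haarUN N = 0
  linarith

/-- **The weighted second moment of the trace.**  For a continuous weight `w ≥ 0` on `U(N)` invariant under left
multiplication by every `P S_i P⁻¹` (`S_i` the sign flip of row `i`, `P ∈ U(N)` fixed):
`∫ w(U) |tr U|² dU ≤ N ∫ w(U) dU` (Haar probability measure).  Proof: `|tr U|² = |tr a|² = Σ_{ij} Re(a_ii ā_jj)`,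
`a = P⁻¹UP`; the cross terms vanish (`integral_mul_re_conj_diag_eq_zero`) and `|a_ii| ≤ 1`. -/
theorem integral_mul_norm_sq_trace_le (P : UN N) {w : UN N → ℝ} (hwc : Continuous w) (hw0 : ∀ U, 0 ≤ w U)
    (hw : ∀ i U, w (P * rowSignUnitary i * P⁻¹ * U) = w U) :
    ∫ U, w U * ‖Matrix.trace (U : Matrix (Fin N) (Fin N) ℂ)‖ ^ 2 ∂haarUN N ≤ N * ∫ U, w U ∂haarUN N := by
  have htr : ∀ U : UN N, ‖Matrix.trace (U : Matrix (Fin N) (Fin N) ℂ)‖ ^ 2 =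
      ∑ i, ∑ j, (((P⁻¹ * U * P : UN N) : Matrix (Fin N) (Fin N) ℂ) i i *
        conj (((P⁻¹ * U * P : UN N) : Matrix (Fin N) (Fin N) ℂ) j j)).re := fun U => by
    rw [← trace_conj_eq P U, norm_sq_trace_eq]
  simp_rw [htr, Finset.mul_sum]
  have hint : ∀ i j : Fin N, Integrable (fun U : UN N => w U *
      (((P⁻¹ * U * P : UN N) : Matrix (Fin N) (Fin N) ℂ) i i *
        conj (((P⁻¹ * U * P : UN N) : Matrix (Fin N) (Fin N) ℂ) j j)).re) (haarUN N) := by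
    intro i j
    refine integrable_of_continuous (hwc.mul ?_)
    exact Complex.continuous_re.comp ((continuous_conj_entry P i i).mul
      (Complex.continuous_conj.comp (continuous_conj_entry P j j)))
  rw [integral_finsetSum _ (fun i _ => integrable_finsetSum _ (fun j _ => hint i j))]
  simp_rw [integral_finsetSum _ (fun j _ => hint _ j)]
  have hinner : ∀ i : Fin N, ∑ j, ∫ U, w U * (((P⁻¹ * U * P : UN N) : Matrix (Fin N) (Fin N) ℂ) i i *
        conj (((P⁻¹ * U * P : UN N) : Matrix (Fin N) (Fin N) ℂ) j j)).re ∂haarUN N =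
      ∫ U, w U * ‖((P⁻¹ * U * P : UN N) : Matrix (Fin N) (Fin N) ℂ) i i‖ ^ 2 ∂haarUN N := by
    intro i
    rw [Finset.sum_eq_single i]
    · refine integral_congr_ae (Eventually.of_forall fun U => ?_)
      dsimp only
      rw [Complex.mul_conj, Complex.normSq_eq_norm_sq]
      norm_cast
    · intro j _ hji
      exact integral_mul_re_conj_diag_eq_zero P (Ne.symm hji) (hw i)
    · intro h; exact absurd (Finset.mem_univ i) h
  simp_rw [hinner]
  have hdiag : ∀ i : Fin N, ∫ U, w U * ‖((P⁻¹ * U * P : UN N) : Matrix (Fin N) (Fin N) ℂ) i i‖ ^ 2 ∂haarUN N ≤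
      ∫ U, w U ∂haarUN N := by
    intro i
    refine integral_mono (integrable_of_continuous (hwc.mul ((continuous_conj_entry P i i).norm.pow 2)))
      (integrable_of_continuous hwc) fun U => ?_
    have h1 : ‖((P⁻¹ * U * P : UN N) : Matrix (Fin N) (Fin N) ℂ) i i‖ ^ 2 ≤ 1 := by
      have h := norm_entry_le_one (P⁻¹ * U * P) i i
      nlinarith [norm_nonneg (((P⁻¹ * U * P : UN N) : Matrix (Fin N) (Fin N) ℂ) i i)]
    simpa using mul_le_mul_of_nonneg_left h1 (hw0 U)
  calc ∑ i : Fin N, ∫ U, w U * ‖((P⁻¹ * U * P : UN N) : Matrix (Fin N) (Fin N) ℂ) i i‖ ^ 2 ∂haarUN N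
      ≤ ∑ _i : Fin N, ∫ U, w U ∂haarUN N := Finset.sum_le_sum fun i _ => hdiag i
    _ = N * ∫ U, w U ∂haarUN N := by simp

/-! ### §2  Two links: the weight of `(A, V)` is invariant under `V ↦ D V` for `D` commuting with `A` -/

/-- The `(0,1)` plaquette trace of the pair `(A, V)` is `tr(V⁻¹ A⁻¹ V A)`. -/
theorem ekPlaqTrace_two_zero_one (A V : UN N) :
    ekPlaqTrace (![A, V] : EKConfig 2 N) 0 1 = Matrix.trace ((V⁻¹ * A⁻¹ * V * A : UN N) : Matrix (Fin N) (Fin N) ℂ) := by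
  rw [ekPlaqTrace_eq_trace_coe]; rfl

/-- The `(1,0)` plaquette trace of the pair `(A, V)` is `tr(A⁻¹ V⁻¹ A V)`. -/
theorem ekPlaqTrace_two_one_zero (A V : UN N) :
    ekPlaqTrace (![A, V] : EKConfig 2 N) 1 0 = Matrix.trace ((A⁻¹ * V⁻¹ * A * V : UN N) : Matrix (Fin N) (Fin N) ℂ) := by
  rw [ekPlaqTrace_eq_trace_coe]; rfl

/-- **Sliding a commuting factor through the plaquette.**  If `D` commutes with `A`, the plaquette words of `(A, D V)` are
those of `(A, V)`: each word carries `V` and `V⁻¹` once, separated by `A^{±1}`. -/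
theorem ekAction_pair_mul_left (A V D : UN N) (h : D * A = A * D) :
    ekAction (![A, D * V] : EKConfig 2 N) = ekAction (![A, V] : EKConfig 2 N) := by
  have h1 : D⁻¹ * A * D = A := by
    rw [mul_assoc, ← h, ← mul_assoc, inv_mul_cancel, one_mul]
  have h2 : D⁻¹ * A⁻¹ * D = A⁻¹ := by
    have : D⁻¹ * A⁻¹ * D = (D⁻¹ * A * D)⁻¹ := by group
    rw [this, h1]
  have e01 : (D * V)⁻¹ * A⁻¹ * (D * V) * A = V⁻¹ * A⁻¹ * V * A := by
    calc (D * V)⁻¹ * A⁻¹ * (D * V) * A = V⁻¹ * (D⁻¹ * A⁻¹ * D) * V * A := by group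
      _ = V⁻¹ * A⁻¹ * V * A := by rw [h2]
  have e10 : A⁻¹ * (D * V)⁻¹ * A * (D * V) = A⁻¹ * V⁻¹ * A * V := by
    calc A⁻¹ * (D * V)⁻¹ * A * (D * V) = A⁻¹ * V⁻¹ * (D⁻¹ * A * D) * V := by group
      _ = A⁻¹ * V⁻¹ * A * V := by rw [h1]
  have hpair : ∀ X Y : UN N, ekAction (![X, Y] : EKConfig 2 N) =
      (1 - (ekPlaqTrace (![X, Y] : EKConfig 2 N) 0 1).re / N) / 2 +
        (1 - (ekPlaqTrace (![X, Y] : EKConfig 2 N) 1 0).re / N) / 2 := fun X Y => by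
    simp [ekAction, Fin.sum_univ_two]
  rw [hpair, hpair, ekPlaqTrace_two_zero_one, ekPlaqTrace_two_zero_one, ekPlaqTrace_two_one_zero,
    ekPlaqTrace_two_one_zero, e01, e10]

/-- Hence the Boltzmann weight of `(A, D V)` equals that of `(A, V)`. -/
theorem ekWeight_pair_mul_left (b : ℝ) (A V D : UN N) (h : D * A = A * D) :
    ekWeight N b (![A, D * V] : EKConfig 2 N) = ekWeight N b (![A, V] : EKConfig 2 N) := by
  unfold ekWeight; rw [ekAction_pair_mul_left A V D h]

/-- The pair `(A, V)` depends continuously on its second link. -/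
theorem continuous_pair (A : UN N) : Continuous fun V : UN N => (![A, V] : EKConfig 2 N) := by
  refine continuous_pi fun i => ?_
  refine Fin.cases ?_ (fun j => ?_) i
  · simpa using continuous_const
  · have hj : j = 0 := Subsingleton.elim _ _
    subst hj
    simpa using continuous_id'

/-- The one-link weight `V ↦ e^{−N² b S_R[A, V]}` is continuous. -/
theorem continuous_ekWeight_pair (b : ℝ) (A : UN N) :
    Continuous fun V : UN N => ekWeight N b (![A, V] : EKConfig 2 N) :=
  (continuous_ekWeight (d := 2) N b).comp (continuous_pair A)

/-- **The one-link inequality at fixed first link**: `∫ e^{−N²bS_R[A,V]} |tr V|² dV ≤ N ∫ e^{−N²bS_R[A,V]} dV` for EVERY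
`A ∈ U(N)` and every `b ∈ ℝ`. -/
theorem integral_ekWeight_pair_mul_norm_sq_trace_le (b : ℝ) (A : UN N) :
    ∫ V, ekWeight N b (![A, V] : EKConfig 2 N) * ‖Matrix.trace (V : Matrix (Fin N) (Fin N) ℂ)‖ ^ 2 ∂haarUN N ≤
      N * ∫ V, ekWeight N b (![A, V] : EKConfig 2 N) ∂haarUN N := by
  obtain ⟨P, hP⟩ := exists_conj_mem_diagonalTorus A
  refine integral_mul_norm_sq_trace_le P (continuous_ekWeight_pair b A) (fun V => (Real.exp_pos _).le) fun i V => ?_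
  exact ekWeight_pair_mul_left b A V _ (conj_rowSign_mul_comm hP i)

/-! ### §3  Fubini over the first link and the bound `⟨|tr U₁/N|²⟩ ≤ 1/N` for `d = 2` -/

/-- `finTwoArrow : (Fin 2 → U(N)) ≃ᵐ U(N) × U(N)` carries `ekHaar 2 N` to `Haar ⊗ Haar`. -/
theorem measurePreserving_finTwoArrow_two (N : ℕ) :
    MeasurePreserving (MeasurableEquiv.finTwoArrow (α := UN N)) (ekHaar 2 N) ((haarUN N).prod (haarUN N)) := by
  unfold ekHaar
  exact MeasureTheory.measurePreserving_finTwoArrow _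

/-- The inverse of `finTwoArrow` builds the pair `![A, V]`. -/
theorem finTwoArrow_symm_pair (A V : UN N) :
    (MeasurableEquiv.finTwoArrow (α := UN N)).symm (A, V) = (![A, V] : EKConfig 2 N) := by
  funext i
  fin_cases i <;> rfl

/-- **Fubini over the first link** for a continuous function of two links. -/
theorem integral_ekHaar_two (F : EKConfig 2 N → ℝ) (hF : Continuous F) :
    ∫ U, F U ∂ekHaar 2 N = ∫ A, (∫ V, F (![A, V] : EKConfig 2 N) ∂haarUN N) ∂haarUN N := by
  have hsymm : MeasurePreserving (MeasurableEquiv.finTwoArrow (α := UN N)).symm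
      ((haarUN N).prod (haarUN N)) (ekHaar 2 N) := (measurePreserving_finTwoArrow_two N).symm _
  have hint : Integrable (fun z : UN N × UN N => F ((MeasurableEquiv.finTwoArrow (α := UN N)).symm z))
      ((haarUN N).prod (haarUN N)) :=
    (hsymm.integrable_comp_emb (MeasurableEquiv.measurableEmbedding _)).2 (integrable_of_continuous_config hF)
  rw [← hsymm.integral_comp' F, integral_prod _ hint]
  simp_rw [finTwoArrow_symm_pair]

/-- The first-link integrand `A ↦ ∫ F(A, V) dV` is integrable. -/
theorem integrable_integral_pair (F : EKConfig 2 N → ℝ) (hF : Continuous F) :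
    Integrable (fun A : UN N => ∫ V, F (![A, V] : EKConfig 2 N) ∂haarUN N) (haarUN N) := by
  have hsymm : MeasurePreserving (MeasurableEquiv.finTwoArrow (α := UN N)).symm
      ((haarUN N).prod (haarUN N)) (ekHaar 2 N) := (measurePreserving_finTwoArrow_two N).symm _
  have hint : Integrable (fun z : UN N × UN N => F ((MeasurableEquiv.finTwoArrow (α := UN N)).symm z))
      ((haarUN N).prod (haarUN N)) :=
    (hsymm.integrable_comp_emb (MeasurableEquiv.measurableEmbedding _)).2 (integrable_of_continuous_config hF)
  simpa only [finTwoArrow_symm_pair] using hint.integral_prod_left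

/-- The open line in direction `1` of the pair `(A, V)` is `tr V / N`. -/
theorem openLine_one_pair (A V : UN N) :
    openLine 1 (![A, V] : EKConfig 2 N) = Matrix.trace (V : Matrix (Fin N) (Fin N) ℂ) / (N : ℂ) := by
  simp [openLine]

/-- The constant bookkeeping `(1/N²) · (N · Z) = Z / N`. -/
theorem one_div_sq_mul_mul {x : ℝ} (hx : x ≠ 0) (Z : ℝ) : 1 / x ^ 2 * (x * Z) = 1 / x * Z := by
  rw [← mul_assoc]
  congr 1
  field_simp

/-- **The pointwise (first-link) inequality**: for every `A`,
`∫ |tr V/N|² e^{−N²bS_R[A,V]} dV ≤ (1/N) ∫ e^{−N²bS_R[A,V]} dV`. -/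
theorem integral_pair_le (hN : 0 < N) (b : ℝ) (A : UN N) :
    ∫ V, ‖openLine 1 (![A, V] : EKConfig 2 N)‖ ^ 2 * ekWeight N b (![A, V] : EKConfig 2 N) ∂haarUN N ≤
      1 / (N : ℝ) * ∫ V, ekWeight N b (![A, V] : EKConfig 2 N) ∂haarUN N := by
  have hN' : (0 : ℝ) < N := Nat.cast_pos.2 hN
  have hsq : ∀ V : UN N, ‖openLine 1 (![A, V] : EKConfig 2 N)‖ ^ 2 * ekWeight N b (![A, V] : EKConfig 2 N) =
      (1 / (N : ℝ) ^ 2) *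
        (ekWeight N b (![A, V] : EKConfig 2 N) * ‖Matrix.trace (V : Matrix (Fin N) (Fin N) ℂ)‖ ^ 2) := by
    intro V
    rw [openLine_one_pair, norm_div, Complex.norm_natCast, div_pow]
    ring
  simp_rw [hsq]
  rw [integral_const_mul]
  calc 1 / (N : ℝ) ^ 2 *
        ∫ V, ekWeight N b (![A, V] : EKConfig 2 N) * ‖Matrix.trace (V : Matrix (Fin N) (Fin N) ℂ)‖ ^ 2 ∂haarUN N
      ≤ 1 / (N : ℝ) ^ 2 * (N * ∫ V, ekWeight N b (![A, V] : EKConfig 2 N) ∂haarUN N) :=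
        mul_le_mul_of_nonneg_left (integral_ekWeight_pair_mul_norm_sq_trace_le b A) (by positivity)
    _ = 1 / (N : ℝ) * ∫ V, ekWeight N b (![A, V] : EKConfig 2 N) ∂haarUN N := one_div_sq_mul_mul hN'.ne' _

/-- **Numerator `≤` denominator`/N`** for the `d = 2` order parameter in direction `1`:
`∫ |tr U₁/N|² e^{−N²bS_R} ≤ (1/N) · Z_EK`. -/
theorem integral_normSq_openLine_mul_ekWeight_le (hN : 0 < N) (b : ℝ) :
    ∫ U, ‖openLine 1 U‖ ^ 2 * ekWeight N b U ∂ekHaar 2 N ≤ (1 / N) * ∫ U, ekWeight N b U ∂ekHaar 2 N := by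
  have hc₁ : Continuous fun U : EKConfig 2 N => ‖openLine 1 U‖ ^ 2 * ekWeight N b U :=
    ((continuous_openLine (d := 2) (N := N) 1).norm.pow 2).mul (continuous_ekWeight (d := 2) N b)
  have hc₂ : Continuous fun U : EKConfig 2 N => ekWeight N b U := continuous_ekWeight (d := 2) N b
  -- integrands passed EXPLICITLY (no higher-order unification against `![A, V]`, no `rw` over Gibbs integrands)
  have h1 := integral_ekHaar_two (fun U : EKConfig 2 N => ‖openLine 1 U‖ ^ 2 * ekWeight N b U) hc₁
  have h2 := integral_ekHaar_two (fun U : EKConfig 2 N => ekWeight N b U) hc₂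
  have hf := integrable_integral_pair (fun U : EKConfig 2 N => ‖openLine 1 U‖ ^ 2 * ekWeight N b U) hc₁
  have hg := (integrable_integral_pair (fun U : EKConfig 2 N => ekWeight N b U) hc₂).const_mul (1 / (N : ℝ))
  have hfg := integral_mono hf hg fun A => integral_pair_le hN b A
  have h3 := integral_const_mul (μ := haarUN N) (1 / (N : ℝ))
    (fun A : UN N => ∫ V, ekWeight N b (![A, V] : EKConfig 2 N) ∂haarUN N)
  calc ∫ U, ‖openLine 1 U‖ ^ 2 * ekWeight N b U ∂ekHaar 2 N
      = ∫ A, (∫ V, ‖openLine 1 (![A, V] : EKConfig 2 N)‖ ^ 2 * ekWeight N b (![A, V] : EKConfig 2 N) ∂haarUN N)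
          ∂haarUN N := h1
    _ ≤ ∫ A, 1 / (N : ℝ) * (∫ V, ekWeight N b (![A, V] : EKConfig 2 N) ∂haarUN N) ∂haarUN N := hfg
    _ = 1 / (N : ℝ) * ∫ A, (∫ V, ekWeight N b (![A, V] : EKConfig 2 N) ∂haarUN N) ∂haarUN N := h3
    _ = 1 / (N : ℝ) * ∫ U, ekWeight N b U ∂ekHaar 2 N := congrArg (fun z : ℝ => 1 / (N : ℝ) * z) h2.symm

end TwoDim

/-! ### §4  The headline statements -/

variable {N : ℕ}

/-- **`⟨|(1/N) tr U_μ|²⟩_EK ≤ 1/N` in `d = 2`, for every real coupling `b`, every `N ≥ 1` and both directions** — the naive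
Eguchi–Kawai model is centre symmetric in two dimensions at EVERY coupling (Makeenko §14.4: the reduction "is valid, strictly
speaking, only in `d = 2`"), quantitatively and at finite `N`.  Sharp at weak coupling. -/
theorem ekOrderParameter_two_le (hN : 0 < N) (b : ℝ) (μ : Fin 2) : ekOrderParameter 2 N b μ ≤ 1 / N := by
  rw [ekOrderParameter_eq 2 N b μ 1]
  unfold ekOrderParameter ekExpectation
  rw [div_le_iff₀ (ekPartition_pos 2 N b)]
  exact TwoDim.integral_normSq_openLine_mul_ekWeight_le hN b

/-- **The reduction hypothesis holds in `d = 2` at every coupling**: `EKOpenLinesVanish 2 b` for all `b ∈ ℝ`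
(evasion (e) of the barrier entry `EguchiKawaiBreakdown`, as a theorem). -/
theorem ekOpenLinesVanish_two (b : ℝ) : EKOpenLinesVanish 2 b := by
  intro μ
  refine tendsto_of_tendsto_of_tendsto_of_le_of_le' tendsto_const_nhds tendsto_one_div_atTop_nhds_zero_nat ?_ ?_
  · exact Eventually.of_forall fun N => ekOrderParameter_nonneg 2 N b μ
  · filter_upwards [eventually_gt_atTop 0] with N hN
    exact ekOrderParameter_two_le hN b μ

/-- In `d = 1` there is no plaquette: the reduced action vanishes identically. -/
theorem ekAction_one_dim (U : EKConfig 1 N) : ekAction U = 0 := by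
  simp [ekAction]

/-- In `d = 1` the Boltzmann weight is `1` at every coupling. -/
theorem ekWeight_one_dim (b : ℝ) (U : EKConfig 1 N) : ekWeight N b U = 1 := by
  simp [ekWeight, ekAction_one_dim]

/-- In `d = 1` the order parameter does not depend on the coupling. -/
theorem ekOrderParameter_one_dim (b : ℝ) (μ : Fin 1) : ekOrderParameter 1 N b μ = ekOrderParameter 1 N 0 μ := by
  unfold ekOrderParameter ekExpectation
  simp only [ekWeight_one_dim]

/-- The reduction hypothesis holds in `d = 1` at every coupling (pure Haar measure, `1/N² → 0`). -/
theorem ekOpenLinesVanish_one (b : ℝ) : EKOpenLinesVanish 1 b := by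
  intro μ
  have h : (fun N : ℕ => ekOrderParameter 1 N b μ) = fun N : ℕ => ekOrderParameter 1 N 0 μ :=
    funext fun N => ekOrderParameter_one_dim b μ
  rw [h]
  exact ekOpenLinesVanish_zero 1 μ

/-- The reduction hypothesis holds vacuously in `d = 0` (no direction). -/
theorem ekOpenLinesVanish_zero_dim (b : ℝ) : EKOpenLinesVanish 0 b := fun μ => μ.elim0

/-- **No Eguchi–Kawai breakdown in dimension `d ≤ 2`, at any coupling.** -/
theorem ekOpenLinesVanish_of_le_two {d : ℕ} (hd : d ≤ 2) (b : ℝ) : EKOpenLinesVanish d b := by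
  interval_cases d
  exacts [ekOpenLinesVanish_zero_dim b, ekOpenLinesVanish_one b, ekOpenLinesVanish_two b]

/-- The same for the gauge group `SU(N)` (the order parameters coincide, `ekOrderParameterSU_eq`). -/
theorem ekOrderParameterSU_two_le (hN : 0 < N) (b : ℝ) (μ : Fin 2) : ekOrderParameterSU 2 N b μ ≤ 1 / N := by
  rw [ekOrderParameterSU_eq]
  exact ekOrderParameter_two_le hN b μ

/-- **No Eguchi–Kawai breakdown for `SU(N)` in dimension `d ≤ 2`, at any coupling.** -/
theorem ekOpenLinesVanishSU_of_le_two {d : ℕ} (hd : d ≤ 2) (b : ℝ) : EKOpenLinesVanishSU d b :=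
  (ekOpenLinesVanishSU_iff d b).2 (ekOpenLinesVanish_of_le_two hd b)

end Summit.QuantumFields.YangMills.Theorems.EguchiKawaiDirectionLadder

end
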